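import Mathlib.Algebra.Module.ZMod
import Mathlib.Algebra.Field.ZMod
import Mathlib.FieldTheory.Finiteness
import Mathlib.LinearAlgebra.Dimension.Free
import Mathlib.GroupTheory.Index
import Mathlib.Data.ZMod.Basic
import HarnessLib

/-!
# X3, the DEGENERATE rows, class-level count: a KERNEL FAMILY independent modulo `p`-th powers
# (pure algebra; cell `bsd-eis`, seat `bsd-eis-x3` gen 9, brick D of x3-MEMO-11; route K1
# `AdditiveBranchIMC`, crux `GordTwoRankZeroOffCaseOne` — supports only)

HONEST FRAMING (`run/shared/lean/pub/bsd-eis/README.md` §4): THEOREMS ONLY (no `def`, no named fact,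
no `sorry`); nothing is booked; no label, tier or count of record moves.

## What

The `S`-unit theorem (tree: `Literature.NumberTheory.DiophantineGeometry.NumberField.sUnit_exist_unique_eq_mul_prod`)
presents an abelian group `A` (the `S`-units of a layer `ℚ_n`) as `T × ⟨ε₁,…,ε_r⟩_free` with `T`
a subgroup (roots of unity): every `y = t·∏ ε_i^{m_i}` and `∏ ε_i^{n_i} ∈ T ⟹ n = 0`. Given a
homomorphism `Φ : A → B` to a finite group killed by `p` of order `≤ p^d` (the local units of the layer
at the prime above `3` modulo cubes, `d = 3ⁿ`, brick B), this file extracts `k ≥ r − d` elements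
`u_j ∈ A` with `Φ(u_j) = 1` which are INDEPENDENT MODULO `p`-TH POWERS AND `T`:
`∏ u_j^{c_j} = t·y^p` (`t ∈ T`, `c_j ∈ {0,…,p−1}`) forces `c = 0` — the input (indep) + (local) of the
table-free U-side bound `X3Branch.pow_card_le_natCard_residualQuotSelmer_of_trivialLine_of_family`
(`X3BranchResidualQuotSelmerFamilyLowerBound.lean`).

* `KummerFamily.exists_kernel_family` — linear algebra over `𝔽_p`: `c ↦ Φ(∏ ε_i^{c_i})` is an additive
  map `ψ : 𝔽_p^r → B` (through `ZMod.lift`), `#ker ψ · #(𝔽_p^r/ker ψ) = p^r` with `#(𝔽_p^r/ker ψ) ≤ #B ≤ p^d`,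
  `ker ψ` is an `𝔽_p`-subspace of dimension `k` with `p^k ≥ p^{r−d}`; a basis `w^{(1)},…,w^{(k)}` gives
  `u_j = ∏ ε_i^{w^{(j)}_i}`; a relation `∏ u_j^{c_j} = t y^p` reads `∏ ε_i^{e_i} = t y^p` with
  `e_i ≡ Σ_j c_j w^{(j)}_i (mod p)`, and the unique representation of `y` forces `p ∣ e_i`, i.e.
  `Σ_j c_j w^{(j)} = 0`, i.e. `c = 0`.
References: [NeukirchANT1999] Ch. I (11.6)–(11.7) (the `S`-unit theorem, shape of `A`); folklore
linear algebra.
-/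

set_option autoImplicit false

noncomputable section

open scoped Classical

namespace Summit.BirchSwinnertonDyer.Rank1Residual.Additive

namespace KummerFamily

open Finset

variable {A : Type*} [CommGroup A] {B : Type*} [CommGroup B]

/-- `∏ ε_i^{n_i}` is additive in the integer exponent vector. [folklore] -/
theorem prod_zpow_add {r : ℕ} (ε : Fin r → A) (n m : Fin r → ℤ) :
    (∏ i, ε i ^ (n i + m i)) = (∏ i, ε i ^ n i) * ∏ i, ε i ^ m i := by
  rw [← Finset.prod_mul_distrib]
  exact Finset.prod_congr rfl fun i _ ↦ zpow_add _ _ _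

/-- **A kernel family independent modulo `p`-th powers.** `A` an abelian group with elements
`ε₁, …, ε_r` and a subgroup `T` such that every `y ∈ A` is `t · ∏ ε_i^{m_i}` (`t ∈ T`, `m ∈ ℤ^r`) and
`∏ ε_i^{n_i} ∈ T ⟹ n = 0`; `B` a finite abelian group with `b^p = 1` for all `b`, `#B ≤ p^d`;
`Φ : A → B` a homomorphism. Then there are `k` elements `u_j ∈ A`, `r ≤ k + d`, with `Φ u_j = 1`, such
that `∏ u_j^{c_j} = t · y^p` with `t ∈ T`, `c : Fin k → ZMod p` (exponents `c_j.val`) forces `c = 0`.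
[cite: NeukirchANT1999, Ch. I (11.6)–(11.7)] -/
theorem exists_kernel_family {p : ℕ} [hp : Fact p.Prime] {r : ℕ} (ε : Fin r → A) (T : Subgroup A)
    (hgen : ∀ y : A, ∃ t ∈ T, ∃ m : Fin r → ℤ, y = t * ∏ i, ε i ^ m i)
    (hind : ∀ n : Fin r → ℤ, (∏ i, ε i ^ n i) ∈ T → n = 0)
    [Finite B] (hB : ∀ b : B, b ^ p = 1) (Φ : A →* B) {d : ℕ} (hcard : Nat.card B ≤ p ^ d) :
    ∃ (k : ℕ) (u : Fin k → A), r ≤ k + d ∧ (∀ j, Φ (u j) = 1) ∧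
      ∀ (c : Fin k → ZMod p) (t : A) (_ : t ∈ T) (y : A),
        (∏ j, u j ^ (c j).val) = t * y ^ p → c = 0 := by
  haveI : NeZero p := ⟨hp.out.ne_zero⟩
  -- the additive map `ψ : 𝔽_p^r → B`, `ψ c = Φ (∏ ε_i^{c_i})`
  let V := Fin r → ZMod p
  have hφ0 : ∀ i : Fin r, (zmultiplesHom (Additive B) (Additive.ofMul (Φ (ε i)))) (p : ℤ) = 0 := by
    intro i
    rw [zmultiplesHom_apply, ← ofMul_zpow, zpow_natCast, hB, ofMul_one]
  let ψi : Fin r → (ZMod p →+ Additive B) := fun i ↦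
    ZMod.lift p ⟨zmultiplesHom (Additive B) (Additive.ofMul (Φ (ε i))), hφ0 i⟩
  have hψi : ∀ (i : Fin r) (c : ZMod p), ψi i c = Additive.ofMul (Φ (ε i) ^ c.val) := by
    intro i c
    conv_lhs => rw [← ZMod.natCast_zmod_val c]
    rw [show ((c.val : ℕ) : ZMod p) = ((c.val : ℤ) : ZMod p) by push_cast; rfl, ZMod.lift_coe]
    change (c.val : ℤ) • Additive.ofMul (Φ (ε i)) = _
    rw [natCast_zsmul, ← ofMul_pow]
  let ψ : V →+ Additive B := ∑ i, (ψi i).comp (Pi.evalAddMonoidHom (fun _ : Fin r ↦ ZMod p) i)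
  have hψ : ∀ c : V, ψ c = Additive.ofMul (Φ (∏ i, ε i ^ (c i).val)) := by
    intro c
    rw [map_prod, ofMul_prod]
    change (∑ i, (ψi i).comp (Pi.evalAddMonoidHom (fun _ : Fin r ↦ ZMod p) i)) c = _
    rw [AddMonoidHom.finsetSum_apply]
    exact Finset.sum_congr rfl fun i _ ↦ by
      rw [AddMonoidHom.comp_apply, Pi.evalAddMonoidHom_apply, hψi, map_pow Φ]
  -- counting: `#ker ψ ≥ p^{r-d}`
  let Kψ : AddSubgroup V := ψ.ker
  let Ks : Submodule (ZMod p) V := AddSubgroup.toZModSubmodule p Kψ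
  have hKs : ∀ x : V, x ∈ Ks ↔ ψ x = 0 := fun x ↦ by
    rw [AddSubgroup.mem_toZModSubmodule]; rfl
  haveI : Finite V := inferInstance
  have hcardV : Nat.card V = p ^ r := by
    rw [Nat.card_fun, Nat.card_zmod, Nat.card_eq_fintype_card, Fintype.card_fin]
  have hquot : Nat.card (V ⧸ Kψ) ≤ p ^ d := by
    have e := QuotientAddGroup.quotientKerEquivRange ψ
    rw [Nat.card_congr e.toEquiv]
    exact (Nat.card_le_card_of_injective _ Subtype.val_injective).trans hcard
  have hmul : Nat.card Kψ * Nat.card (V ⧸ Kψ) = p ^ r := by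
    rw [mul_comm, ← hcardV]; exact (AddSubgroup.card_eq_card_quotient_mul_card_addSubgroup Kψ).symm
  set k := Module.finrank (ZMod p) Ks with hk
  have hcardK : Nat.card Kψ = p ^ k := by
    have h := Module.natCard_eq_pow_finrank (K := ZMod p) (V := Ks)
    rw [Nat.card_zmod] at h
    rw [← h]; rfl
  have hrk : r ≤ k + d := by
    have h1 : p ^ r ≤ p ^ k * p ^ d := by
      rw [← hmul, hcardK]; exact Nat.mul_le_mul_left _ hquot
    rw [← pow_add] at h1
    exact (Nat.pow_le_pow_iff_right hp.out.one_lt).mp h1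
  -- a basis of the kernel and the family
  let bK := Module.finBasis (ZMod p) Ks
  have hbK : Module.finrank (ZMod p) Ks = k := rfl
  let w : Fin k → V := fun j ↦ (bK j : Ks)
  have hwker : ∀ j, ψ (w j) = 0 := fun j ↦ (hKs _).mp (bK j).2
  refine ⟨k, fun j ↦ ∏ i, ε i ^ ((w j) i).val, hrk, fun j ↦ ?_, fun c t ht y hrel ↦ ?_⟩
  · have := hwker j
    rw [hψ] at this
    exact Additive.ofMul.injective this
  · -- the exponent vector `e_i = Σ_j c_j.val · (w j i).val`
    set e : Fin r → ℕ := fun i ↦ ∑ j, (c j).val * ((w j) i).val with he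
    have hprod : (∏ j, (∏ i, ε i ^ ((w j) i).val) ^ (c j).val) = ∏ i, ε i ^ e i := by
      simp_rw [← Finset.prod_pow, ← pow_mul, he]
      rw [Finset.prod_comm]
      exact Finset.prod_congr rfl fun i _ ↦ by
        rw [← Finset.prod_pow_eq_pow_sum]
        exact Finset.prod_congr rfl fun j _ ↦ by rw [mul_comm]
    rw [hprod] at hrel
    -- `y = t' ∏ ε^m`, so `∏ ε^{e - p m} ∈ T`
    obtain ⟨t', ht', m, hy⟩ := hgen y
    have hyp : y ^ p = t' ^ p * ∏ i, ε i ^ ((p : ℤ) * m i) := by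
      rw [hy, mul_pow, ← Finset.prod_pow]
      congr 1
      exact Finset.prod_congr rfl fun i _ ↦ by rw [← zpow_natCast, ← zpow_mul, mul_comm]
    have hmemT : (∏ i, ε i ^ ((e i : ℤ) - (p : ℤ) * m i)) ∈ T := by
      have hsplit : (∏ i, ε i ^ ((e i : ℤ) - (p : ℤ) * m i)) =
          (∏ i, ε i ^ (e i : ℤ)) * (∏ i, ε i ^ ((p : ℤ) * m i))⁻¹ := by
        rw [← Finset.prod_inv_distrib, ← Finset.prod_mul_distrib]
        exact Finset.prod_congr rfl fun i _ ↦ by rw [zpow_sub]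
      have hnat : (∏ i, ε i ^ (e i : ℤ)) = ∏ i, ε i ^ e i :=
        Finset.prod_congr rfl fun i _ ↦ zpow_natCast _ _
      rw [hsplit, hnat, hrel, hyp]
      have : t * (t' ^ p * ∏ i, ε i ^ ((p : ℤ) * m i)) * (∏ i, ε i ^ ((p : ℤ) * m i))⁻¹ =
          t * t' ^ p := by
        rw [← mul_assoc, mul_assoc (t * t' ^ p), mul_inv_cancel, mul_one]
      rw [this]
      exact T.mul_mem ht (T.pow_mem ht' p)
    have hzero := hind _ hmemT
    -- hence `Σ_j c_j • w j = 0` in `V`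
    have hsum : (∑ j, c j • w j) = 0 := by
      funext i
      rw [Finset.sum_apply, Pi.zero_apply]
      have hi : ((e i : ℤ) : ZMod p) = (((p : ℤ) * m i : ℤ) : ZMod p) := by
        have := congrFun hzero i
        rw [Pi.zero_apply, sub_eq_zero] at this
        rw [this]
      rw [Int.cast_mul, Int.cast_natCast, Int.cast_natCast, ZMod.natCast_self, zero_mul] at hi
      have hcast : ((e i : ℕ) : ZMod p) = ∑ j, (c j • w j) i := by
        rw [he]
        push_cast
        exact Finset.sum_congr rfl fun j _ ↦ by simp only [ZMod.natCast_zmod_val]; rfl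
      rw [← hcast, hi]
    -- independence of the basis
    have hsum' : (∑ j, c j • (bK j : Ks)) = 0 := by
      apply Subtype.ext
      rw [Submodule.coe_sum, Submodule.coe_zero, ← hsum]
      exact Finset.sum_congr rfl fun j _ ↦ by rw [Submodule.coe_smul]
    exact funext fun j ↦ by
      have := Fintype.linearIndependent_iff.mp bK.linearIndependent c hsum' j
      exact this

end KummerFamily

end Summit.BirchSwinnertonDyer.Rank1Residual.Additive

end
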